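import Mathlib
import HarnessLib
import Summits.NavierStokesRegularity.NavierStokesRegularity.Theorems.LocalSineTubeDoorEnstrophyProductionProfileRigidity

/-!
# K2 `PoloidalWindowRigidity` (stmt-NavierStokesRegularity-19708), residue (G″): ENSTROPHY GRONWALL FROM `t = −∞`
# — profiles whose enstrophy production stays below the critical rate are trivial; the poloidal
# «small horizontal strain» stratum (CENSUS-K2G §16, mechanism M9; K2 lead nsreg-p7 gen 4)

For a profile `v` of the route's Type-I class (`‖v(t,x)‖ ≤ C/√(−t)`, continuity on the open slab, unit-viscosity
Oseen–Duhamel identity between negative times, divergence-free slices) the enstrophy density `q = |ω|²`,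
`ω = curl v`, obeys the pointwise balance `∂ₜq + (v·∇)q − Δq = 2⟪ω, Dv ω⟫ − 2|∇ω|²_F`
(tree `…EnstrophyProductionProfileRigidity.enstrophyDensity_balance`, p6).  If a positive weight `g(t)` with
`2 g ⟪ω, Dv ω⟫ + g′ |ω|² ≤ 0` pointwise is available, then `Q = g q` is a bounded SUB-solution on every slab
`[t₀, t₁] × ℝ³`, so the whole-space maximum principle (tree `…BoundedSubsolutionMaxPrinciple.le_of_bounded_subsolution`)
and the class vorticity rate `|ω(t₀)| ≤ C₂/(−t₀)` (tree `…ClassRate.exists_curl_rate_of_class`) give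
`q(t₁, x) ≤ g(t₀) C₂²/(t₀² g(t₁))`; whenever `g(s)/s² → 0` as `s → −∞` the profile is irrotational, hence zero
(tree `…Degenerate.eq_zero_of_irrotational`):

* `curl_eq_zero_of_weighted_production` — the core (any profile of the class, any admissible weight);
* `eq_zero_of_subcritical_production` — weight `g = (−t)^{2Λ}`: **a profile whose enstrophy production satisfies
  `⟪ω, Dv ω⟫ ≤ Λ |ω|²/(−t)` with `Λ < 1` is identically zero** (`Λ = 0` contains p6's production-free theorem;
  `Λ = 1` is the critical rate, where the a-priori bound `(−t)²|ω|² ≤ C₂²` is exactly scale-invariant);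
* `eq_zero_of_small_horizontal_strain` — POLOIDAL profiles (`⟪curl v, e₃⟫ ≡ 0`): the production is
  `ω_hᵀ (∇_h v_h) ω_h`, so **a poloidal profile whose horizontal strain stays below the critical rate,
  `(−t) ⟪Dv(t,y) a, a⟫ ≤ Λ ‖a‖²` for horizontal `a` with `Λ < 1`, is identically zero** — the residue (G″) of the
  line `slicesharp-screw` must stretch some horizontal direction at the critical rate (CENSUS-K2G §16.2);
* the stub-currency corollaries `nonflatLiouville_of_subcritical_production`, `nonflatLiouville_of_small_horizontal_strain`.

The vertically periodic stratum (CENSUS-K2G §16.3: there the horizontal strain is `O(L (−t)^{−3/2})`, an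
integrable rate) is the companion file `…VerticalPeriod`.

WHAT THIS IS NOT: not a proof of K2 and nothing about Clay (A) — two more settled strata of the residue of crux
`PoloidalWindowRigidity` (bears_on LADDER-NS N0, route PoloidalWindowDoor); establishment in the cell's sense needs the
cross-family referee PASS + independent reproduction.
-/

noncomputable section

-- the summit and its single sub-problem share the name (CONVENTIONS §1), as in every Theorems file
set_option linter.dupNamespace false

namespace Summit.NavierStokesRegularity.NavierStokesRegularity.Theorems.PoloidalWindowDoorPoloidalWindowRigidityStrainRate

open MeasureTheory Set Function Filter Topology TopologicalSpace Metric InnerProductSpace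
open scoped RealInnerProductSpace InnerProductSpace Laplacian ContDiff
open Literature.Analysis Literature.Analysis.FluidPDE
open Summit.NavierStokesRegularity.NavierStokesRegularity.Theorems.LocalSineTubeDoorProfileAlignedWindowRigidityAncient
open Summit.NavierStokesRegularity.NavierStokesRegularity.Theorems.PoloidalWindowDoorPoloidalWindowRigidityWindow
open Summit.NavierStokesRegularity.NavierStokesRegularity.Theorems.PoloidalWindowDoorPoloidalWindowRigidityDegenerate
open Summit.NavierStokesRegularity.NavierStokesRegularity.Theorems.PoloidalWindowDoorPoloidalWindowRigidityClassRate
open Summit.NavierStokesRegularity.NavierStokesRegularity.Theorems.LocalSineTubeDoorBoundedSubsolutionMaxPrinciple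
open Summit.NavierStokesRegularity.NavierStokesRegularity.Theorems.LocalSineTubeDoorEnstrophyProductionProfileRigidity

variable {C : ℝ} {v : ℝ → EuclideanSpace ℝ (Fin 3) → EuclideanSpace ℝ (Fin 3)}

/-! ### the weighted enstrophy density is a sub-solution -/

/-- **The weighted enstrophy density `Q = g(t) |ω|²` of a profile of the class is a sub-solution** of
`∂ₜQ + DQ(v) − ΔQ ≤ 0` at every point of the open slab, as soon as the weight `g ≥ 0` (derivative `g′`) absorbs the
production: `2 g(t) ⟪ω, Dv ω⟫ + g′(t) |ω|² ≤ 0` pointwise.  (`∂ₜQ + DQ(v) − ΔQ = g′q + g(2⟪ω,Dvω⟫ − 2|∇ω|²_F)`.) -/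
theorem weightedEnstrophy_subsolution (hrate : HasTypeITimeDecay C v)
    (hcont : ContinuousOn (uncurry v) (Iio (0 : ℝ) ×ˢ univ))
    (hmild : ∀ s t : ℝ, s < t → t < 0 → ∀ x,
      v t x = UnboundedOperators.heatExtension (v s) (t - s) x - oseenDuhamel 1 s v v t x)
    (hdiv : ∀ t < 0, VectorCalculus.IsDivFree (v t))
    {g g' : ℝ → ℝ} (hg : ∀ t < 0, HasDerivAt g (g' t) t) (hg0 : ∀ t < 0, 0 ≤ g t)
    (hprod : ∀ s < 0, ∀ y, 2 * g s * ⟪curl (v s) y, fderiv ℝ (v s) y (curl (v s) y)⟫_ℝ +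
      g' s * ⟪curl (v s) y, curl (v s) y⟫_ℝ ≤ 0)
    {t : ℝ} (ht : t < 0) (x : EuclideanSpace ℝ (Fin 3)) :
    HasDerivAt (fun τ => g τ * ⟪curl (v τ) x, curl (v τ) x⟫_ℝ)
        (deriv (fun τ => g τ * ⟪curl (v τ) x, curl (v τ) x⟫_ℝ) t) t ∧
      deriv (fun τ => g τ * ⟪curl (v τ) x, curl (v τ) x⟫_ℝ) t +
          fderiv ℝ (fun y => g t * ⟪curl (v t) y, curl (v t) y⟫_ℝ) x (v t x) -
          (Δ (fun y => g t * ⟪curl (v t) y, curl (v t) y⟫_ℝ)) x ≤ 0 := by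
  have hA : IsTypeIAncientMild C v := isTypeIAncientMild_of_class hrate hcont hmild hdiv
  have ht₀ : t - 1 < 0 := by linarith
  have htI : t ∈ Ioo (t - 1) 0 := ⟨by linarith, ht⟩
  obtain ⟨p, hcl⟩ := hA.exists_isClassicalNSSolutionOn_Ioo ht₀
  have hbal := enstrophyDensity_balance isOpen_Ioo hcl htI x
  -- the enstrophy density `q` and its time derivative within the open window = the two-sided derivative
  set q : ℝ → EuclideanSpace ℝ (Fin 3) → ℝ := fun τ y => ⟪curl (v τ) y, curl (v τ) y⟫_ℝ with hqdef
  have hdω : HasDerivWithinAt (fun τ => vorticity v τ x) (timeDerivWithin (Ioo (t - 1) 0) (vorticity v) t x)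
      (Ioo (t - 1) 0) t := by
    rw [timeDerivWithin_apply]
    exact ((hcl.smooth_velocity.isSmoothSpaceTimeOn_vorticity isOpen_Ioo.uniqueDiffOn).differentiableWithinAt_time
      htI x).hasDerivWithinAt
  have hq : HasDerivAt (fun τ => q τ x)
      (⟪vorticity v t x, timeDerivWithin (Ioo (t - 1) 0) (vorticity v) t x⟫_ℝ +
        ⟪timeDerivWithin (Ioo (t - 1) 0) (vorticity v) t x, vorticity v t x⟫_ℝ) t := by
    have h := (hdω.inner ℝ hdω).hasDerivAt (isOpen_Ioo.mem_nhds htI)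
    simpa only [vorticity_apply] using h
  have hqd : HasDerivAt (fun τ => q τ x) (deriv (fun τ => q τ x) t) t := hq.differentiableAt.hasDerivAt
  have hderiv : deriv (fun τ => q τ x) t =
      timeDerivWithin (Ioo (t - 1) 0) (fun τ y => ⟪curl (v τ) y, curl (v τ) y⟫_ℝ) t x := by
    rw [timeDerivWithin_apply, derivWithin_of_isOpen isOpen_Ioo htI]
  -- the weighted density
  have hQ : HasDerivAt (fun τ => g τ * q τ x) (g' t * q t x + g t * deriv (fun τ => q τ x) t) t :=
    (hg t ht).mul hqd
  refine ⟨hQ.differentiableAt.hasDerivAt, ?_⟩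
  rw [hQ.deriv]
  -- spatial derivatives of `y ↦ g t * q t y`
  have hΩ2 : ContDiff ℝ 2 (curl (v t)) :=
    contDiff_curl (n := 2) (analyticOnNhd_slice hcont (bdd_of_hasTypeITimeDecay hrate) hmild ht).contDiff
  have hq2 : ContDiff ℝ 2 (q t) := hΩ2.inner ℝ hΩ2
  have hsm : (fun y => g t * q t y) = g t • q t := by funext y; simp [hqdef]
  have hfd : fderiv ℝ (fun y => g t * q t y) x (v t x) = g t * fderiv ℝ (q t) x (v t x) := by
    rw [hsm, fderiv_const_smul (hq2.differentiable (by norm_num) x)]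
    simp
  have hlap : (Δ (fun y => g t * q t y)) x = g t * (Δ (q t)) x := by
    rw [hsm, laplacian_smul (g t) (hq2.contDiffAt (x := x))]
    simp
  rw [hfd, hlap, hderiv]
  -- the balance with unit viscosity
  have h1 : (1 : ℝ) * (Δ (fun y => ⟪curl (v t) y, curl (v t) y⟫_ℝ)) x =
      (Δ (fun y => ⟪curl (v t) y, curl (v t) y⟫_ℝ)) x := one_mul _
  have hbal' : timeDerivWithin (Ioo (t - 1) 0) (fun τ y => ⟪curl (v τ) y, curl (v τ) y⟫_ℝ) t x =
      2 * ⟪curl (v t) x, fderiv ℝ (v t) x (curl (v t) x)⟫_ℝ - 2 * 1 * frobeniusNormSq (fderiv ℝ (curl (v t)) x) -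
        fderiv ℝ (fun y => ⟪curl (v t) y, curl (v t) y⟫_ℝ) x (v t x) +
        1 * (Δ (fun y => ⟪curl (v t) y, curl (v t) y⟫_ℝ)) x := by
    linarith [hbal]
  have hfrob := frobeniusNormSq_nonneg (fderiv ℝ (curl (v t)) x)
  have hP := hprod t ht x
  have hgt := hg0 t ht
  simp only [hqdef] at hbal' ⊢
  rw [hbal']
  nlinarith [mul_nonneg hgt hfrob]

/-! ### the core: weighted maximum principle from `t = −∞` -/

/-- **ENSTROPHY GRONWALL FROM `t = −∞` (core).**  Let `v` be a profile of the class and `g > 0` a weight on `(−∞,0)`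
with derivative `g′`, absorbing the enstrophy production (`2 g ⟪ω, Dv ω⟫ + g′|ω|² ≤ 0` pointwise) and with
`g(s)/s² → 0` as `s → −∞`.  Then `curl v ≡ 0`.  Proof: `Q = g|ω|²` is a bounded sub-solution on `[t₀,t₁] × ℝ³`, so
`g(t₁)|ω(t₁,x)|² ≤ sup Q(t₀,·) ≤ g(t₀)(C₂/(−t₀))²` (class vorticity rate), and the right side tends to `0`. -/
theorem curl_eq_zero_of_weighted_production (hrate : HasTypeITimeDecay C v)
    (hcont : ContinuousOn (uncurry v) (Iio (0 : ℝ) ×ˢ univ))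
    (hmild : ∀ s t : ℝ, s < t → t < 0 → ∀ x,
      v t x = UnboundedOperators.heatExtension (v s) (t - s) x - oseenDuhamel 1 s v v t x)
    (hdiv : ∀ t < 0, VectorCalculus.IsDivFree (v t))
    {g g' : ℝ → ℝ} (hg : ∀ t < 0, HasDerivAt g (g' t) t) (hgpos : ∀ t < 0, 0 < g t)
    (hglim : Tendsto (fun s => g s / s ^ 2) atBot (𝓝 0))
    (hprod : ∀ s < 0, ∀ y, 2 * g s * ⟪curl (v s) y, fderiv ℝ (v s) y (curl (v s) y)⟫_ℝ +
      g' s * ⟪curl (v s) y, curl (v s) y⟫_ℝ ≤ 0) :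
    ∀ t < 0, ∀ x, curl (v t) x = 0 := by
  have hA : IsTypeIAncientMild C v := isTypeIAncientMild_of_class hrate hcont hmild hdiv
  obtain ⟨C₂, hC₂⟩ := exists_curl_rate_of_class hrate hcont hmild
  have hC₂0 : 0 ≤ C₂ := by
    have h := hC₂ (-1) (by norm_num) 0
    rw [neg_neg, div_one] at h
    exact (norm_nonneg _).trans h
  have hg0 : ∀ t < 0, 0 ≤ g t := fun t ht => (hgpos t ht).le
  -- the densities
  set q : ℝ → EuclideanSpace ℝ (Fin 3) → ℝ := fun τ y => ⟪curl (v τ) y, curl (v τ) y⟫_ℝ with hqdef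
  set Q : ℝ → EuclideanSpace ℝ (Fin 3) → ℝ := fun τ y => g τ * q τ y with hQdef
  set Qt : ℝ → EuclideanSpace ℝ (Fin 3) → ℝ := fun τ y => deriv (fun τ' => Q τ' y) τ with hQtdef
  have hsmω : IsSmoothSpaceTimeOn (Iio 0) (vorticity v) :=
    (show IsSmoothSpaceTimeOn (Iio 0) v from hA.contDiffOn).isSmoothSpaceTimeOn_vorticity isOpen_Iio.uniqueDiffOn
  have hqbd : ∀ t < 0, ∀ x, q t x ≤ (C₂ / (-t)) ^ 2 := fun t ht x => by
    simp only [hqdef, real_inner_self_eq_norm_sq]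
    exact pow_le_pow_left₀ (norm_nonneg _) (hC₂ t ht x) 2
  have hq0 : ∀ t x, 0 ≤ q t x := fun t x => by simp only [hqdef]; exact real_inner_self_nonneg
  -- continuity of `g` on `(−∞, 0)`
  have hgc : ∀ t < 0, ContinuousAt g t := fun t ht => (hg t ht).continuousAt
  intro t₁ ht₁ x₁
  -- `g(t₁) q(t₁, x₁) ≤ g(t₀) (C₂/(−t₀))²` for every `t₀ < t₁`
  have hkey : ∀ t₀ < t₁, g t₁ * q t₁ x₁ ≤ g t₀ * (C₂ / (-t₀)) ^ 2 := by
    intro t₀ ht₀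
    -- drift bound on `[t₀, t₁]`
    obtain ⟨B, hB⟩ := bdd_of_hasTypeITimeDecay hrate (-t₁ / 2) (by linarith)
    have hbA : ∀ t ∈ Icc t₀ t₁, ∀ x, ‖v t x‖ ≤ B := fun t ht x => hB t (by linarith [ht.2]) x
    -- `g` is continuous on the compact interval, hence bounded there
    have hgco : ContinuousOn g (Icc t₀ t₁) := fun t ht =>
      (hgc t (lt_of_le_of_lt ht.2 ht₁)).continuousWithinAt
    obtain ⟨G, hG⟩ := (isCompact_Icc.image_of_continuousOn hgco).isBounded.exists_norm_le
    have hGt : ∀ t ∈ Icc t₀ t₁, g t ≤ G := fun t ht =>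
      (le_abs_self _).trans ((Real.norm_eq_abs _).symm.le.trans (hG _ (mem_image_of_mem g ht)))
    -- continuity of `Q` on the closed slab
    have hq_c : ContinuousOn (uncurry q) (Icc t₀ t₁ ×ˢ univ) := by
      have hωc : ContinuousOn (uncurry (vorticity v)) (Icc t₀ t₁ ×ˢ univ) :=
        hsmω.continuousOn.mono (prod_mono (fun t ht => lt_of_le_of_lt ht.2 ht₁) Subset.rfl)
      have h : ContinuousOn (fun z => ⟪uncurry (vorticity v) z, uncurry (vorticity v) z⟫_ℝ) (Icc t₀ t₁ ×ˢ univ) :=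
        hωc.inner hωc
      refine h.congr fun z _ => ?_
      simp only [hqdef, uncurry, vorticity_apply]
    have hQ_c : ContinuousOn (uncurry Q) (Icc t₀ t₁ ×ˢ univ) := by
      have hg1 : ContinuousOn (fun z : ℝ × EuclideanSpace ℝ (Fin 3) => g z.1) (Icc t₀ t₁ ×ˢ univ) :=
        hgco.comp continuous_fst.continuousOn (fun z hz => (mem_prod.1 hz).1)
      refine (hg1.mul hq_c).congr fun z _ => ?_
      rcases z with ⟨a, b⟩
      rfl
    -- smooth slices
    have hq2 : ∀ t ∈ Icc t₀ t₁, ContDiff ℝ 2 (q t) := fun t ht => by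
      have htn : t < 0 := lt_of_le_of_lt ht.2 ht₁
      have hΩ : ContDiff ℝ 2 (curl (v t)) :=
        contDiff_curl (n := 2) (analyticOnNhd_slice hcont (bdd_of_hasTypeITimeDecay hrate) hmild htn).contDiff
      exact hΩ.inner ℝ hΩ
    have hQ2 : ∀ t ∈ Icc t₀ t₁, ContDiff ℝ 2 (Q t) := fun t ht => by
      have h : ContDiff ℝ 2 (fun y => g t * q t y) := contDiff_const.mul (hq2 t ht)
      exact h
    -- time derivative and the sub-solution inequality
    have hsub := fun t (ht : t ∈ Icc t₀ t₁) x =>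
      weightedEnstrophy_subsolution hrate hcont hmild hdiv hg hg0 hprod (lt_of_le_of_lt ht.2 ht₁) x
    have hQt : ∀ x, ∀ t ∈ Icc t₀ t₁, HasDerivAt (fun τ => Q τ x) (Qt t x) t := fun x t ht => (hsub t ht x).1
    have hlaw : ∀ t ∈ Icc t₀ t₁, ∀ x, Qt t x + fderiv ℝ (Q t) x (v t x) - (Δ (Q t)) x ≤ 0 :=
      fun t ht x => (hsub t ht x).2
    -- bounds
    have hbdd : ∀ t ∈ Icc t₀ t₁, ∀ x, |Q t x| ≤ G * (C₂ / (-t₁)) ^ 2 := fun t ht x => by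
      have htn : t < 0 := lt_of_le_of_lt ht.2 ht₁
      have hQ0 : 0 ≤ Q t x := mul_nonneg (hg0 t htn) (hq0 t x)
      rw [abs_of_nonneg hQ0]
      have h1 : C₂ / (-t) ≤ C₂ / (-t₁) := div_le_div_of_nonneg_left hC₂0 (by linarith) (by linarith [ht.2])
      have h2 : (C₂ / (-t)) ^ 2 ≤ (C₂ / (-t₁)) ^ 2 := pow_le_pow_left₀ (div_nonneg hC₂0 (by linarith)) h1 2
      exact mul_le_mul (hGt t ht) ((hqbd t htn x).trans h2) (hq0 t x) ((hg0 t htn).trans (hGt t ht))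
    have hinit : ∀ x, Q t₀ x ≤ g t₀ * (C₂ / (-t₀)) ^ 2 := fun x =>
      mul_le_mul_of_nonneg_left (hqbd t₀ (ht₀.trans ht₁) x) (hg0 t₀ (ht₀.trans ht₁))
    exact le_of_bounded_subsolution ht₀ hbA hQ_c hQ2 hQt hlaw hbdd hinit t₁ ⟨ht₀.le, le_rfl⟩ x₁
  -- let `t₀ → −∞`: `g(t₀)(C₂/(−t₀))² = C₂² · (g(t₀)/t₀²) → 0`
  have hlim : Tendsto (fun s => g s * (C₂ / (-s)) ^ 2) atBot (𝓝 0) := by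
    have h : (fun s => g s * (C₂ / (-s)) ^ 2) = fun s => C₂ ^ 2 * (g s / s ^ 2) := by
      funext s
      rw [div_pow, neg_sq]
      ring
    rw [h]
    simpa using hglim.const_mul (C₂ ^ 2)
  have hgt₁ := hgpos t₁ ht₁
  have hqle : q t₁ x₁ ≤ 0 := by
    refine le_of_forall_pos_le_add fun η hη => ?_
    rw [zero_add]
    -- eventually `g(s)(C₂/(−s))² < g(t₁) η`
    have hev : ∀ᶠ s in atBot, g s * (C₂ / (-s)) ^ 2 < g t₁ * η :=
      (hlim.eventually (gt_mem_nhds (mul_pos hgt₁ hη)))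
    obtain ⟨t₀, ht₀lt, ht₀b⟩ := (hev.and (eventually_lt_atBot t₁)).exists
    have h := (hkey t₀ ht₀b).trans ht₀lt.le
    -- divide by `g(t₁) > 0`
    by_contra hcon
    push Not at hcon
    have : g t₁ * η < g t₁ * q t₁ x₁ := mul_lt_mul_of_pos_left hcon hgt₁
    linarith
  have hq00 : q t₁ x₁ = 0 := le_antisymm hqle (hq0 t₁ x₁)
  simpa only [hqdef, inner_self_eq_zero] using hq00

/-! ### rate `Λ/(−t)`, `Λ < 1`: sub-critical production -/

/-- **PROFILES WITH SUB-CRITICAL ENSTROPHY PRODUCTION ARE IRROTATIONAL.**  If the production of a profile of the class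
satisfies `⟪ω, Dv ω⟫(s,y) ≤ Λ |ω(s,y)|²/(−s)` for all `s < 0`, `y`, with a constant `Λ < 1`, then `curl v ≡ 0`
(weight `g(t) = (−t)^{2Λ}`: `t ↦ (−t)^{2Λ} sup|ω(t)|²` is non-increasing, and `≤ C₂² (−t)^{2Λ−2} → 0` at `−∞`). -/
theorem curl_eq_zero_of_subcritical_production (hrate : HasTypeITimeDecay C v)
    (hcont : ContinuousOn (uncurry v) (Iio (0 : ℝ) ×ˢ univ))
    (hmild : ∀ s t : ℝ, s < t → t < 0 → ∀ x,
      v t x = UnboundedOperators.heatExtension (v s) (t - s) x - oseenDuhamel 1 s v v t x)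
    (hdiv : ∀ t < 0, VectorCalculus.IsDivFree (v t))
    {Λ : ℝ} (hΛ : Λ < 1)
    (hprod : ∀ s < 0, ∀ y, (-s) * ⟪curl (v s) y, fderiv ℝ (v s) y (curl (v s) y)⟫_ℝ ≤
      Λ * ⟪curl (v s) y, curl (v s) y⟫_ℝ) :
    ∀ t < 0, ∀ x, curl (v t) x = 0 := by
  -- WLOG `0 ≤ Λ` (the hypothesis with `Λ` implies it with `max Λ 0`)
  set Λ' : ℝ := max Λ 0 with hΛ'
  have hΛ'0 : 0 ≤ Λ' := le_max_right _ _
  have hΛ'1 : Λ' < 1 := max_lt hΛ one_pos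
  have hprod' : ∀ s < 0, ∀ y, (-s) * ⟪curl (v s) y, fderiv ℝ (v s) y (curl (v s) y)⟫_ℝ ≤
      Λ' * ⟪curl (v s) y, curl (v s) y⟫_ℝ := fun s hs y =>
    (hprod s hs y).trans (mul_le_mul_of_nonneg_right (le_max_left _ _) real_inner_self_nonneg)
  -- the weight `g(t) = (−t)^{2Λ'}` and its derivative
  set g : ℝ → ℝ := fun t => (-t) ^ (2 * Λ') with hgdef
  set g' : ℝ → ℝ := fun t => -(2 * Λ') * (-t) ^ (2 * Λ' - 1) with hg'def
  have hg : ∀ t < 0, HasDerivAt g (g' t) t := by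
    intro t ht
    have hnt : 0 < -t := neg_pos.2 ht
    have h1 : HasDerivAt (fun τ : ℝ => -τ) (-1) t := hasDerivAt_neg t
    have h2 := h1.rpow_const (p := 2 * Λ') (Or.inl hnt.ne')
    simp only [hgdef, hg'def]
    convert h2 using 1
    ring
  have hgpos : ∀ t < 0, 0 < g t := fun t ht => by
    simp only [hgdef]; exact Real.rpow_pos_of_pos (neg_pos.2 ht) _
  have hglim : Tendsto (fun s => g s / s ^ 2) atBot (𝓝 0) := by
    -- `g s / s² = (−s)^{2Λ' − 2}` for `s < 0`, and `2Λ' − 2 < 0`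
    have hneg : 2 * Λ' - 2 < 0 := by linarith
    have h1 : Tendsto (fun s : ℝ => (-s) ^ (2 * Λ' - 2)) atBot (𝓝 0) := by
      have h := (tendsto_rpow_neg_atTop (y := -(2 * Λ' - 2)) (by linarith)).comp tendsto_neg_atBot_atTop
      refine h.congr' (Eventually.of_forall fun s => ?_)
      simp only [Function.comp, neg_neg]
    refine h1.congr' ?_
    filter_upwards [eventually_lt_atBot (0 : ℝ)] with s hs
    have hns : 0 < -s := neg_pos.2 hs
    simp only [hgdef]
    rw [Real.rpow_sub hns, Real.rpow_two, neg_sq]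
  have hprod2 : ∀ s < 0, ∀ y, 2 * g s * ⟪curl (v s) y, fderiv ℝ (v s) y (curl (v s) y)⟫_ℝ +
      g' s * ⟪curl (v s) y, curl (v s) y⟫_ℝ ≤ 0 := by
    intro s hs y
    have hns : 0 < -s := neg_pos.2 hs
    have hP := hprod' s hs y
    -- `g s = (−s) · (−s)^{2Λ'−1}`
    have hsplit : g s = (-s) * (-s) ^ (2 * Λ' - 1) := by
      have h := Real.rpow_add hns 1 (2 * Λ' - 1)
      rw [Real.rpow_one] at h
      simp only [hgdef]
      rw [← h]
      congr 1
      ring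
    have hpow : 0 < (-s) ^ (2 * Λ' - 1) := Real.rpow_pos_of_pos hns _
    simp only [hg'def]
    rw [hsplit]
    nlinarith [mul_le_mul_of_nonneg_left hP hpow.le]
  exact curl_eq_zero_of_weighted_production hrate hcont hmild hdiv hg hgpos hglim hprod2

/-- **PROFILES WITH SUB-CRITICAL ENSTROPHY PRODUCTION ARE TRIVIAL** (`Λ < 1`; `Λ = 0` contains the production-free
stratum of p6's `…EnstrophyProductionProfileRigidity`). -/
theorem eq_zero_of_subcritical_production (hrate : HasTypeITimeDecay C v)
    (hcont : ContinuousOn (uncurry v) (Iio (0 : ℝ) ×ˢ univ))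
    (hmild : ∀ s t : ℝ, s < t → t < 0 → ∀ x,
      v t x = UnboundedOperators.heatExtension (v s) (t - s) x - oseenDuhamel 1 s v v t x)
    (hdiv : ∀ t < 0, VectorCalculus.IsDivFree (v t))
    {Λ : ℝ} (hΛ : Λ < 1)
    (hprod : ∀ s < 0, ∀ y, (-s) * ⟪curl (v s) y, fderiv ℝ (v s) y (curl (v s) y)⟫_ℝ ≤
      Λ * ⟪curl (v s) y, curl (v s) y⟫_ℝ) :
    ∀ t < 0, ∀ x, v t x = 0 :=
  eq_zero_of_irrotational hrate hcont hmild hdiv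
    (curl_eq_zero_of_subcritical_production hrate hcont hmild hdiv hΛ hprod)

/-- Stub currency: a profile of the class with sub-critical enstrophy production is not backward-singular. -/
theorem nonflatLiouville_of_subcritical_production (hrate : HasTypeITimeDecay C v)
    (hcont : ContinuousOn (uncurry v) (Iio (0 : ℝ) ×ˢ univ))
    (hmild : ∀ s t : ℝ, s < t → t < 0 → ∀ x,
      v t x = UnboundedOperators.heatExtension (v s) (t - s) x - oseenDuhamel 1 s v v t x)
    (hdiv : ∀ t < 0, VectorCalculus.IsDivFree (v t))
    {Λ : ℝ} (hΛ : Λ < 1)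
    (hprod : ∀ s < 0, ∀ y, (-s) * ⟪curl (v s) y, fderiv ℝ (v s) y (curl (v s) y)⟫_ℝ ≤
      Λ * ⟪curl (v s) y, curl (v s) y⟫_ℝ) :
    ¬ IsBackwardSingularPoint v 0 :=
  nonflatLiouville_of_irrotational hrate hcont hmild hdiv
    (curl_eq_zero_of_subcritical_production hrate hcont hmild hdiv hΛ hprod)

/-! ### the poloidal stratum «horizontal strain below the critical rate» -/

/-- For a POLOIDAL field (`⟪curl u(y), e₃⟫ = 0`) the enstrophy production only sees the HORIZONTAL block of the
velocity gradient: if `(−s)⟪Du(y) a, a⟫ ≤ Λ‖a‖²` for every horizontal `a` (`⟪a, e₃⟫ = 0`), then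
`(−s)⟪ω, Du ω⟫ ≤ Λ |ω|²` at `y`. -/
theorem production_le_of_horizontal_strain {u : EuclideanSpace ℝ (Fin 3) → EuclideanSpace ℝ (Fin 3)}
    {s Λ : ℝ} {y : EuclideanSpace ℝ (Fin 3)}
    (hpol : ⟪curl u y, EuclideanSpace.single 2 (1 : ℝ)⟫_ℝ = 0)
    (hstrain : ∀ a : EuclideanSpace ℝ (Fin 3), ⟪a, EuclideanSpace.single 2 (1 : ℝ)⟫_ℝ = 0 →
      (-s) * ⟪fderiv ℝ u y a, a⟫_ℝ ≤ Λ * ‖a‖ ^ 2) :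
    (-s) * ⟪curl u y, fderiv ℝ u y (curl u y)⟫_ℝ ≤ Λ * ⟪curl u y, curl u y⟫_ℝ := by
  have h := hstrain (curl u y) hpol
  rw [real_inner_comm] at h
  rwa [real_inner_self_eq_norm_sq]

/-- **THE «SMALL HORIZONTAL STRAIN» STRATUM OF THE RESIDUE IS EMPTY.**  A profile of the class, poloidal along `e₃`
on every slice, whose horizontal strain stays below the critical rate — `(−s) ⟪Dv(s,y) a, a⟫ ≤ Λ ‖a‖²` for all
`s < 0`, `y` and horizontal `a`, with `Λ < 1` — is identically zero.  Equivalently (CENSUS-K2G §16.2): a member of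
the residue (G″) stretches some horizontal direction at rate `> Λ/(−s)` for every `Λ < 1`. -/
theorem eq_zero_of_small_horizontal_strain (hrate : HasTypeITimeDecay C v)
    (hcont : ContinuousOn (uncurry v) (Iio (0 : ℝ) ×ˢ univ))
    (hmild : ∀ s t : ℝ, s < t → t < 0 → ∀ x,
      v t x = UnboundedOperators.heatExtension (v s) (t - s) x - oseenDuhamel 1 s v v t x)
    (hdiv : ∀ t < 0, VectorCalculus.IsDivFree (v t))
    (hpol : ∀ s < 0, ∀ y, ⟪curl (v s) y, EuclideanSpace.single 2 (1 : ℝ)⟫_ℝ = 0)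
    {Λ : ℝ} (hΛ : Λ < 1)
    (hstrain : ∀ s < 0, ∀ (y a : EuclideanSpace ℝ (Fin 3)), ⟪a, EuclideanSpace.single 2 (1 : ℝ)⟫_ℝ = 0 →
      (-s) * ⟪fderiv ℝ (v s) y a, a⟫_ℝ ≤ Λ * ‖a‖ ^ 2) :
    ∀ t < 0, ∀ x, v t x = 0 :=
  eq_zero_of_subcritical_production hrate hcont hmild hdiv hΛ fun s hs y =>
    production_le_of_horizontal_strain (hpol s hs y) (hstrain s hs y)

/-- Stub currency: **the «small horizontal strain» stratum of the residue is settled** — such a profile is not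
backward-singular. -/
theorem nonflatLiouville_of_small_horizontal_strain (hrate : HasTypeITimeDecay C v)
    (hcont : ContinuousOn (uncurry v) (Iio (0 : ℝ) ×ˢ univ))
    (hmild : ∀ s t : ℝ, s < t → t < 0 → ∀ x,
      v t x = UnboundedOperators.heatExtension (v s) (t - s) x - oseenDuhamel 1 s v v t x)
    (hdiv : ∀ t < 0, VectorCalculus.IsDivFree (v t))
    (hpol : ∀ s < 0, ∀ y, ⟪curl (v s) y, EuclideanSpace.single 2 (1 : ℝ)⟫_ℝ = 0)
    {Λ : ℝ} (hΛ : Λ < 1)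
    (hstrain : ∀ s < 0, ∀ (y a : EuclideanSpace ℝ (Fin 3)), ⟪a, EuclideanSpace.single 2 (1 : ℝ)⟫_ℝ = 0 →
      (-s) * ⟪fderiv ℝ (v s) y a, a⟫_ℝ ≤ Λ * ‖a‖ ^ 2) :
    ¬ IsBackwardSingularPoint v 0 :=
  nonflatLiouville_of_irrotational hrate hcont hmild hdiv
    (curl_eq_zero_of_subcritical_production hrate hcont hmild hdiv hΛ fun s hs y =>
      production_le_of_horizontal_strain (hpol s hs y) (hstrain s hs y))

end Summit.NavierStokesRegularity.NavierStokesRegularity.Theorems.PoloidalWindowDoorPoloidalWindowRigidityStrainRate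

end
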